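import Summits.AtomisticToContinuum.Crystallization.Theorems.OverbindingBudgetAffineRunCutAxialWindowGain

/-!
# `OverbindingBudget` / crux `RobustDefectLimitWindows` (stmt-AtomisticToContinuum-31280) — «RunCut»: the column gains over the axial window AS A PROFILE in the own scale

Support file (lens-4 g86, hand-in 3 part 0; memo `g86/memo/SW-G1.md` §9).  `…AxialWindowGain` exports the UNIFORM floors `−1/250000` (TRIPLE) and
`−1/500000` (SWAP) over `a ∈ [21/25, 101/50]`, `|t − 2/3| ≤ 1/340`; the budget of the stack-swap (memo §3) is charged POINTWISE in `a` against the
`a`-dependent gain (`2.835·10⁻⁴` at `a = .85`, `2.30·10⁻⁴` at `1`, `4.74·10⁻⁶` at `2` for TRIPLE), because every cost line scales with `a` as well.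
This file exports that profile — an explicit polynomial in `a⁻⁶` — with NO range hypothesis on `a` (the range is only needed for the sign):
`G_T(a) = −[4·Ĵ₂(a) + 6·T̂(a)]`, `G_S(a) = −[2·Ĵ₂(a) + 4·T̂(a)]`, where `Ĵ₂(a) = a⁻¹²·0.0002161/12 − a⁻⁶·0.0004712/6` (`windowJ_two_le`) and
`T̂(a) = a⁻¹²·0.000004790304961/12 + a⁻⁶·0.0000037012/6 + (a⁻¹²/60000 + 21·a⁻⁶)/(5·21⁵)` (`partial_sum_window_le`).
[this file: 0 definitions, 2 theorems; imports `…AxialWindowGain`; standard axioms]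
-/

namespace Summit.AtomisticToContinuum.Crystallization.Theorems.OverbindingBudgetAffineRunCutAxialWindowProfile

open Finset
open Literature.MathematicalPhysics.StatisticalMechanics
open Literature.MathematicalPhysics.StatisticalMechanics.StackingSums
open Summit.AtomisticToContinuum.Crystallization.Theorems.OverbindingBudgetAffineRunCutAxialWindow
open Summit.AtomisticToContinuum.Crystallization.Theorems.OverbindingBudgetAffineRunCutAxialWindowGain
open Summit.AtomisticToContinuum.Crystallization.Theorems.OverbindingBudgetAffineRunCutWord
open Summit.AtomisticToContinuum.Crystallization.Theorems.OverbindingBudgetAffineRunCutColumnGain (sum_Icc_three_eq_sum_range)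

/-- ★ **TRIPLE column gain over the axial window, profile form**: for ANY own scale `a` and `|t − 2/3| ≤ 1/340`, six equal steps, `K ≥ 2`, `M ≥ 3`,
the range-`K` stacking energy of the column changes under the TRIPLE slip by at most `4·Ĵ₂(a) + 6·T̂(a) = −G_T(a)`
(`G_T(.85) = 2.835·10⁻⁴`, `G_T(1) = 2.30·10⁻⁴`, `G_T(2) = 4.74·10⁻⁶`; `G_T ≥ 1/250000` on `[21/25, 101/50]` is `triple_column_gain_window`). [this file · kind: proof] -/
theorem triple_column_gain_profile (a : ℝ) {t : ℝ} (ht : |t - 2 / 3| ≤ 1 / 340)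
    {s : ℤ → ℤ} {j : ℤ} (hs : IsHaggSeq s)
    (hrun6 : s (j - 3) = s (j - 2) ∧ s (j - 2) = s (j - 1) ∧ s (j - 1) = s j ∧ s j = s (j + 1) ∧ s (j + 1) = s (j + 2))
    {K M : ℕ} (hK : 2 ≤ K) (hM : 3 ≤ M) :
    ∑ m ∈ Icc (j - M) (j + M),
        (haggLocalEnergyTrunc K (barlowCoupling lennardJones a (a * Real.sqrt t)) (tripleFlip j s) m
          - haggLocalEnergyTrunc K (barlowCoupling lennardJones a (a * Real.sqrt t)) s m)
      ≤ 4 * (1 / 12 * (a⁻¹) ^ 12 * 0.0002161 - 1 / 6 * (a⁻¹) ^ 6 * 0.0004712)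
        + 6 * ((1 / 12 * (a⁻¹) ^ 12 * 0.000004790304961 + 1 / 6 * (a⁻¹) ^ 6 * 0.0000037012) +
            (1 / 12 * (a⁻¹) ^ 12 * (1 / 5000) + 1 / 6 * (a⁻¹) ^ 6 * 126) * (1 / 5 * ((21 : ℝ)⁻¹) ^ 5)) := by
  have h1 := triple_localEnergyTrunc_le hs hrun6 (barlowCoupling lennardJones a (a * Real.sqrt t)) hK hM
  rw [sum_Icc_three_eq_sum_range] at h1
  have h2 := windowJ_two_le a ht
  have h3 := partial_sum_window_le a ht (K - 2)
  linarith

/-- ★ **SWAP column gain over the axial window, profile form**: five equal steps, `K ≥ 2`, `M ≥ 2`: the change is at most `2·Ĵ₂(a) + 4·T̂(a) = −G_S(a)`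
(`G_S(.85) = 1.35·10⁻⁴`, `G_S(1) = 1.11·10⁻⁴`, `G_S(2) = 2.2·10⁻⁶`; `G_S ≥ 1/500000` on `[21/25, 101/50]` is `swap_column_gain_window`). [this file · kind: proof] -/
theorem swap_column_gain_profile (a : ℝ) {t : ℝ} (ht : |t - 2 / 3| ≤ 1 / 340)
    {s : ℤ → ℤ} {j : ℤ} (hs : IsHaggSeq s)
    (hrun5 : s (j - 2) = s (j - 1) ∧ s (j - 1) = s j ∧ s j = s (j + 1) ∧ s (j + 1) = s (j + 2))
    {K M : ℕ} (hK : 2 ≤ K) (hM : 2 ≤ M) :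
    ∑ m ∈ Icc (j - M) (j + M),
        (haggLocalEnergyTrunc K (barlowCoupling lennardJones a (a * Real.sqrt t)) (swapFlip j s) m
          - haggLocalEnergyTrunc K (barlowCoupling lennardJones a (a * Real.sqrt t)) s m)
      ≤ 2 * (1 / 12 * (a⁻¹) ^ 12 * 0.0002161 - 1 / 6 * (a⁻¹) ^ 6 * 0.0004712)
        + 4 * ((1 / 12 * (a⁻¹) ^ 12 * 0.000004790304961 + 1 / 6 * (a⁻¹) ^ 6 * 0.0000037012) +
            (1 / 12 * (a⁻¹) ^ 12 * (1 / 5000) + 1 / 6 * (a⁻¹) ^ 6 * 126) * (1 / 5 * ((21 : ℝ)⁻¹) ^ 5)) := by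
  have h1 := swap_localEnergyTrunc_le hs hrun5 (barlowCoupling lennardJones a (a * Real.sqrt t)) hK hM
  rw [sum_Icc_three_eq_sum_range] at h1
  have h2 := windowJ_two_le a ht
  have h3 := partial_sum_window_le a ht (K - 2)
  linarith

end Summit.AtomisticToContinuum.Crystallization.Theorems.OverbindingBudgetAffineRunCutAxialWindowProfile
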